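import Literature.Geometry.Riemannian.GradientShrinkerProofs
import Literature.Geometry.Riemannian.PerelmanMuLowerBound
import Summits.SmoothPoincare4.SmoothPoincare4.Theorems.EntropyRungSubcylindricalExistenceEntropyLocalisation
import HarnessLib

/-!
# The Yamabe–Sobolev inequality of a scalar-positive conformal class
(stub `yamabeSobolev_conformal`, helper H10 of line `green-blowup-conformal-entropy`, crux
`EntropyRung.SubcylindricalExistence`, item stmt-SmoothPoincare4-10871)

On a closed smooth `4`-manifold `M` of the summit binder let `g` be a smooth Riemannian metric
(Levi-Civita connection) with scalar curvature `R > 0`. We prove: there is `Y > 0` such that for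
every smooth `ψ > 0` and every smooth `u`,
`Y (∫ u⁴ ψ⁴ dV_g)^{1/2} ≤ ∫ (6 ψ² |∇u|²_g + ψ (R ψ − 6 Δ_g ψ) u²) dV_g`,
i.e. the Sobolev–Yamabe inequality `Y ‖u‖²_{L⁴(ĝ)} ≤ ∫ (6|∇u|²_ĝ + R_ĝ u²) dV_ĝ` for every metric
`ĝ = ψ² g` of the conformal class with ONE constant. Proof:
* conformal invariance (`integral_conformal_eq`): by `|∇(ψu)|² = ψ²|∇u|² + 2ψu g⁻¹(dψ, du) +
  u²|∇ψ|²` (`EntropyLocalisation.gradSq_mul`) and Green's first identity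
  `∫ (u²ψ) Δψ = −∫ g⁻¹(d(u²ψ), dψ)` (`integral_mul_dalembertian_riemVolume`, Lee 2018, Problem 2-23)
  the right-hand side equals `∫ (6|∇(ψu)|²_g + R (ψu)²) dV_g`;
* the case `ψ = 1`: the Sobolev inequality of the closed manifold, `‖v‖₄ ≤ A‖∇v‖₂ + B‖v‖₂`
  (`exists_sobolev_const`, Hebey 1999, Thm. 2.6; `n = 4`, `p = 2`, `p* = 4`), squared:
  `(∫ v⁴)^{1/2} ≤ 2A² ∫|∇v|² + 2B² ∫ v²`, and `∫ (6|∇v|² + R v²) ≥ 6 ∫|∇v|² + (min R) ∫ v²`.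
Everything is proved; no definition, no named fact. References: Lee–Parker 1987, §3 (conformal
invariance of the Yamabe functional); Hebey 1999, Thm. 2.6; Lee 2018, Problem 2-23.
-/

noncomputable section

-- the registered namespace `Summit.SmoothPoincare4.SmoothPoincare4.Theorems` repeats a component
set_option linter.dupNamespace false

open scoped Manifold ContDiff Topology ENNReal NNReal
open Set Filter MeasureTheory
open Literature.Geometry.Lorentzian Literature.Geometry.Riemannian

namespace Summit.SmoothPoincare4.SmoothPoincare4.Theorems

namespace YamabeSobolev

variable {M : Type} [TopologicalSpace M]
  [ChartedSpace (EuclideanSpace ℝ (Fin 4)) M] [IsManifold (𝓡 4) ∞ M]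
  (g : PseudoRiemannianMetric (𝓡 4) ∞ (EuclideanSpace ℝ (Fin 4)) (TangentSpace (𝓡 4) : M → Type _))

/-- `g⁻¹(d(u²ψ), dψ) = u² |∇ψ|² + 2 u ψ g⁻¹(du, dψ)` (product rule and bilinearity). -/
theorem innerDual_dcov_sq_mul {u ψ : M → ℝ} {x : M} (hu : MDifferentiableAt (𝓡 4) 𝓘(ℝ, ℝ) u x)
    (hψ : MDifferentiableAt (𝓡 4) 𝓘(ℝ, ℝ) ψ x) :
    g.innerDual x (mvfderiv (𝓡 4) (fun y ↦ u y * u y * ψ y) x : TangentSpace (𝓡 4) x →ₗ[ℝ] ℝ)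
        (mvfderiv (𝓡 4) ψ x : TangentSpace (𝓡 4) x →ₗ[ℝ] ℝ) =
      u x ^ 2 * g.gradSq ψ x + 2 * (u x * ψ x) *
        g.innerDual x (mvfderiv (𝓡 4) u x : TangentSpace (𝓡 4) x →ₗ[ℝ] ℝ)
          (mvfderiv (𝓡 4) ψ x : TangentSpace (𝓡 4) x →ₗ[ℝ] ℝ) := by
  have huu : MDifferentiableAt (𝓡 4) 𝓘(ℝ, ℝ) (fun y ↦ u y * u y) x := hu.mul hu
  rw [EntropyLocalisation.dcov_mul huu hψ, EntropyLocalisation.dcov_mul hu hu]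
  simp only [g.innerDual_add_left, g.innerDual_smul_left, PseudoRiemannianMetric.gradSq]
  ring

section Integral

variable [T2Space M] [CompactSpace M] [T3Space M] [MeasurableSpace M] [BorelSpace M]

/-- **Conformal invariance of the Yamabe energy** (the quadratic form of `L_g = R − 6Δ` in
dimension four): for smooth `ψ, u` on the closed manifold,
`∫ (6 ψ² |∇u|² + ψ (R ψ − 6 Δψ) u²) dV = ∫ (6 |∇(ψu)|² + R (ψu)²) dV`
(`|∇(ψu)|² = ψ²|∇u|² + 2ψu g⁻¹(dψ,du) + u²|∇ψ|²` and Green's identity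
`∫ u²ψ Δψ = −∫ g⁻¹(d(u²ψ), dψ) = −∫ (u²|∇ψ|² + 2uψ g⁻¹(du,dψ))`). Lee–Parker 1987, §3. -/
theorem integral_conformal_eq [g.HasLeviCivita] (hg : g.IsRiemannian) {ψ u : M → ℝ}
    (hψ : ContMDiff (𝓡 4) 𝓘(ℝ, ℝ) ∞ ψ) (hu : ContMDiff (𝓡 4) 𝓘(ℝ, ℝ) ∞ u) :
    ∫ x, (6 * (ψ x ^ 2 * g.gradSq u x)
        + ψ x * (g.scalarCurvature x * ψ x - 6 * g.dalembertian ψ x) * u x ^ 2) ∂g.riemVolume =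
      ∫ x, (6 * g.gradSq (fun y ↦ ψ y * u y) x + g.scalarCurvature x * (ψ x * u x) ^ 2)
        ∂g.riemVolume := by
  -- regularity
  have hψ1 : ContMDiff (𝓡 4) 𝓘(ℝ, ℝ) 1 ψ := hψ.of_le (by norm_num)
  have hψ2 : ContMDiff (𝓡 4) 𝓘(ℝ, ℝ) 2 ψ := hψ.of_le (WithTop.coe_le_coe.mpr le_top)
  have hF : ContMDiff (𝓡 4) 𝓘(ℝ, ℝ) ∞ (fun y ↦ u y * u y * ψ y) := (hu.mul hu).mul hψ
  have hF1 : ContMDiff (𝓡 4) 𝓘(ℝ, ℝ) 1 (fun y ↦ u y * u y * ψ y) := hF.of_le (by norm_num)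
  have hψc : Continuous ψ := hψ.continuous
  have huc : Continuous u := hu.continuous
  have hRc : Continuous g.scalarCurvature := g.contMDiff_scalarCurvature.continuous
  have hΔc : Continuous (g.dalembertian ψ) := continuous_dalembertian g hψ2
  have hIc := continuous_innerDual_mvfderiv g hF1 hψ1
  have hGc : Continuous (g.gradSq fun y ↦ ψ y * u y) := (contMDiff_gradSq g (hψ.mul hu)).continuous
  have hGu : Continuous (g.gradSq u) := (contMDiff_gradSq g hu).continuous
  -- Green's first identity for `u²ψ` against `ψ`
  have hGreen := integral_mul_dalembertian_riemVolume g hg hF1 hψ2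
  -- the pointwise identity of the integrands
  have hpt : (fun x ↦ 6 * (ψ x ^ 2 * g.gradSq u x)
      + ψ x * (g.scalarCurvature x * ψ x - 6 * g.dalembertian ψ x) * u x ^ 2) =
      fun x ↦ (6 * g.gradSq (fun y ↦ ψ y * u y) x + g.scalarCurvature x * (ψ x * u x) ^ 2)
        - 6 * (g.innerDual x
            (mvfderiv (𝓡 4) (fun y ↦ u y * u y * ψ y) x : TangentSpace (𝓡 4) x →ₗ[ℝ] ℝ)
            (mvfderiv (𝓡 4) ψ x : TangentSpace (𝓡 4) x →ₗ[ℝ] ℝ)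
          + u x * u x * ψ x * g.dalembertian ψ x) := by
    funext x
    have hux : MDifferentiableAt (𝓡 4) 𝓘(ℝ, ℝ) u x := (hu x).mdifferentiableAt (by simp)
    have hψx : MDifferentiableAt (𝓡 4) 𝓘(ℝ, ℝ) ψ x := (hψ x).mdifferentiableAt (by simp)
    rw [EntropyLocalisation.gradSq_mul g hψx hux, innerDual_dcov_sq_mul g hux hψx,
      g.innerDual_comm x (mvfderiv (𝓡 4) ψ x : TangentSpace (𝓡 4) x →ₗ[ℝ] ℝ)
        (mvfderiv (𝓡 4) u x : TangentSpace (𝓡 4) x →ₗ[ℝ] ℝ)]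
    ring
  -- integrability of the continuous integrands on the closed manifold
  have iA : Integrable (fun x ↦ 6 * g.gradSq (fun y ↦ ψ y * u y) x
      + g.scalarCurvature x * (ψ x * u x) ^ 2) g.riemVolume :=
    g.integrable_of_continuous ((continuous_const.mul hGc).add (hRc.mul ((hψc.mul huc).pow 2)))
  have iI : Integrable (fun x ↦ g.innerDual x
      (mvfderiv (𝓡 4) (fun y ↦ u y * u y * ψ y) x : TangentSpace (𝓡 4) x →ₗ[ℝ] ℝ)
      (mvfderiv (𝓡 4) ψ x : TangentSpace (𝓡 4) x →ₗ[ℝ] ℝ)) g.riemVolume :=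
    g.integrable_of_continuous hIc
  have iF : Integrable (fun x ↦ u x * u x * ψ x * g.dalembertian ψ x) g.riemVolume :=
    g.integrable_of_continuous (((huc.mul huc).mul hψc).mul hΔc)
  have iB : Integrable (fun x ↦ 6 * (g.innerDual x
      (mvfderiv (𝓡 4) (fun y ↦ u y * u y * ψ y) x : TangentSpace (𝓡 4) x →ₗ[ℝ] ℝ)
      (mvfderiv (𝓡 4) ψ x : TangentSpace (𝓡 4) x →ₗ[ℝ] ℝ)
        + u x * u x * ψ x * g.dalembertian ψ x)) g.riemVolume := (iI.add iF).const_mul 6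
  rw [hpt, integral_sub iA iB, integral_const_mul, integral_add iI iF, hGreen]
  ring

omit [T2Space M] in
/-- `Lᵖ` norms of continuous functions on the closed manifold are finite. -/
theorem eLpNorm_ne_top_of_continuous {F : M → ℝ} (hF : Continuous F) (p : ℝ≥0∞) :
    eLpNorm F p g.riemVolume ≠ ⊤ := by
  haveI : IsFiniteMeasure g.riemVolume := ⟨g.riemVolume_univ_lt_top⟩
  obtain ⟨C, hC⟩ := (isCompact_range hF).isBounded.exists_norm_le
  exact (MemLp.of_bound hF.aestronglyMeasurable C (ae_of_all _ fun x ↦ hC _ ⟨x, rfl⟩)).eLpNorm_ne_top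

/-- `‖F‖²_{L⁴} = √(∫ F⁴)` for a continuous real function on the closed manifold. -/
theorem toReal_eLpNorm_four_sq {F : M → ℝ} (hF : Continuous F) :
    (eLpNorm F 4 g.riemVolume).toReal ^ 2 = Real.sqrt (∫ x, F x ^ 4 ∂g.riemVolume) := by
  have hint : Integrable (fun x ↦ F x ^ 4) g.riemVolume := g.integrable_of_continuous (hF.pow 4)
  have hpt : ∀ x, (‖F x‖ₑ : ℝ≥0∞) ^ (4 : ℝ) = ENNReal.ofReal (F x ^ 4) := fun x ↦ by
    rw [← ofReal_norm, Real.norm_eq_abs, ENNReal.ofReal_rpow_of_nonneg (abs_nonneg _) (by norm_num),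
      show (4 : ℝ) = ((4 : ℕ) : ℝ) by norm_num, Real.rpow_natCast, Even.pow_abs ⟨2, rfl⟩]
  rw [eLpNorm_eq_lintegral_rpow_enorm_toReal (by norm_num) ENNReal.ofNat_ne_top,
    ENNReal.toReal_ofNat, ← ENNReal.toReal_rpow,
    integral_eq_lintegral_of_nonneg_ae (ae_of_all _ fun x ↦ by positivity) hint.aestronglyMeasurable]
  simp_rw [hpt]
  rw [Real.sqrt_eq_rpow, ← Real.rpow_natCast _ 2, ← Real.rpow_mul ENNReal.toReal_nonneg]
  norm_num

/-- **The Sobolev inequality of the closed `4`-manifold, squared and in real form**: there are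
`A, B ≥ 0` with `(∫ v⁴ dV)^{1/2} ≤ A ∫ |∇v|² dV + B ∫ v² dV` for every smooth `v`
(`exists_sobolev_const` with `n = 4`, `p = 2`, `p* = 4`: `‖v‖₄ ≤ A₀‖∇v‖₂ + B₀‖v‖₂`, squared with
`(a + b)² ≤ 2a² + 2b²`). Hebey 1999, Thm. 2.6. -/
theorem exists_sobolev_sq (hg : g.IsRiemannian) :
    ∃ A B : ℝ, 0 ≤ A ∧ 0 ≤ B ∧ ∀ v : M → ℝ, ContMDiff (𝓡 4) 𝓘(ℝ, ℝ) ∞ v →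
      Real.sqrt (∫ x, v x ^ 4 ∂g.riemVolume) ≤
        A * ∫ x, g.gradSq v x ∂g.riemVolume + B * ∫ x, v x ^ 2 ∂g.riemVolume := by
  obtain ⟨A, B, hS⟩ := exists_sobolev_const g hg (p := 2) (p' := 4) (by norm_num)
    (by rw [finrank_euclideanSpace_fin]; norm_num) (by rw [finrank_euclideanSpace_fin]; norm_num)
  refine ⟨2 * (A : ℝ) ^ 2, 2 * (B : ℝ) ^ 2, by positivity, by positivity, fun v hv ↦ ?_⟩
  have hv1 : ContMDiff (𝓡 4) 𝓘(ℝ, ℝ) 1 v := hv.of_le (by norm_num)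
  have hvc : Continuous v := hv.continuous
  have hGc : Continuous (g.gradSq v) := (contMDiff_gradSq g hv).continuous
  have hGnn : ∀ x, 0 ≤ g.gradSq v x := fun x ↦ g.innerDual_self_nonneg hg x _
  have hX0 : 0 ≤ ∫ x, g.gradSq v x ∂g.riemVolume := integral_nonneg hGnn
  have hV0 : 0 ≤ ∫ x, v x ^ 2 ∂g.riemVolume := integral_nonneg fun x ↦ sq_nonneg _
  have hSv := hS v hv1
  rw [show ((2 : ℝ≥0) : ℝ≥0∞) = (2 : ℝ≥0∞) from rfl,
    show ((4 : ℝ≥0) : ℝ≥0∞) = (4 : ℝ≥0∞) from rfl] at hSv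
  have hA : (A : ℝ≥0∞) * eLpNorm (fun x ↦ Real.sqrt (g.gradSq v x)) 2 g.riemVolume ≠ ⊤ :=
    ENNReal.mul_ne_top ENNReal.coe_ne_top (eLpNorm_ne_top_of_continuous g hGc.sqrt 2)
  have hB : (B : ℝ≥0∞) * eLpNorm v 2 g.riemVolume ≠ ⊤ :=
    ENNReal.mul_ne_top ENNReal.coe_ne_top (eLpNorm_ne_top_of_continuous g hvc 2)
  have h := ENNReal.toReal_mono (ENNReal.add_ne_top.2 ⟨hA, hB⟩) hSv
  rw [ENNReal.toReal_add hA hB, ENNReal.toReal_mul, ENNReal.toReal_mul, ENNReal.coe_toReal,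
    ENNReal.coe_toReal, toReal_eLpNorm_two_eq_sqrt g hGc.sqrt, toReal_eLpNorm_two_eq_sqrt g hvc,
    integral_congr_ae (ae_of_all _ fun x ↦ Real.sq_sqrt (hGnn x))] at h
  -- `h : ‖v‖₄ ≤ A √X + B √V`
  rw [← toReal_eLpNorm_four_sq g hvc]
  have hN : 0 ≤ (eLpNorm v 4 g.riemVolume).toReal := ENNReal.toReal_nonneg
  calc (eLpNorm v 4 g.riemVolume).toReal ^ 2
      ≤ (A * Real.sqrt (∫ x, g.gradSq v x ∂g.riemVolume)
          + B * Real.sqrt (∫ x, v x ^ 2 ∂g.riemVolume)) ^ 2 := pow_le_pow_left₀ hN h 2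
    _ ≤ 2 * (A : ℝ) ^ 2 * Real.sqrt (∫ x, g.gradSq v x ∂g.riemVolume) ^ 2
          + 2 * (B : ℝ) ^ 2 * Real.sqrt (∫ x, v x ^ 2 ∂g.riemVolume) ^ 2 := by
        nlinarith [sq_nonneg ((A : ℝ) * Real.sqrt (∫ x, g.gradSq v x ∂g.riemVolume)
          - B * Real.sqrt (∫ x, v x ^ 2 ∂g.riemVolume))]
    _ = _ := by rw [Real.sq_sqrt hX0, Real.sq_sqrt hV0]

/-- **The Yamabe–Sobolev inequality of a scalar-positive conformal class** (volume measure
`g.riemVolume`): if `R > 0` there is `Y > 0` with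
`Y (∫ u⁴ψ⁴ dV)^{1/2} ≤ ∫ (6ψ²|∇u|² + ψ(Rψ − 6Δψ)u²) dV` for all smooth `ψ > 0` and smooth `u`.
With `v = ψu`: the right side is `∫ (6|∇v|² + Rv²) ≥ 6∫|∇v|² + r∫v²` (`r = min R > 0`) and the
left side is `Y (∫ v⁴)^{1/2} ≤ Y (A∫|∇v|² + B∫v²)`; `Y = r/(rA + B + r)` works. -/
theorem yamabeSobolev_conformal_riemVolume [g.HasLeviCivita] (hg : g.IsRiemannian)
    (hR : ∀ x, 0 < g.scalarCurvature x) :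
    ∃ Y : ℝ, 0 < Y ∧ ∀ (ψ : M → ℝ), ContMDiff (𝓡 4) 𝓘(ℝ, ℝ) ∞ ψ → (∀ x, 0 < ψ x) →
      ∀ (u : M → ℝ), ContMDiff (𝓡 4) 𝓘(ℝ, ℝ) ∞ u →
        Y * Real.sqrt (∫ x, u x ^ 4 * ψ x ^ 4 ∂g.riemVolume) ≤
          ∫ x, (6 * (ψ x ^ 2 * g.gradSq u x)
            + ψ x * (g.scalarCurvature x * ψ x - 6 * g.dalembertian ψ x) * u x ^ 2)
            ∂g.riemVolume := by
  have hRc : Continuous g.scalarCurvature := g.contMDiff_scalarCurvature.continuous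
  -- a positive lower bound `r` of `R` (compactness; vacuous on an empty manifold)
  obtain ⟨r, hr, hrR⟩ : ∃ r : ℝ, 0 < r ∧ ∀ x, r ≤ g.scalarCurvature x := by
    rcases isEmpty_or_nonempty M with hM | hM
    · exact ⟨1, one_pos, fun x ↦ hM.elim x⟩
    · obtain ⟨x₀, -, hx₀⟩ := isCompact_univ.exists_isMinOn univ_nonempty hRc.continuousOn
      exact ⟨_, hR x₀, fun x ↦ (isMinOn_iff.1 hx₀) x (mem_univ x)⟩
  obtain ⟨A, B, hA, hB, hS⟩ := exists_sobolev_sq g hg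
  have hK : 0 < r * A + B + r := by positivity
  refine ⟨r / (r * A + B + r), div_pos hr hK, fun ψ hψ _ u hu ↦ ?_⟩
  have hv : ContMDiff (𝓡 4) 𝓘(ℝ, ℝ) ∞ (fun y ↦ ψ y * u y) := hψ.mul hu
  have hvc : Continuous (fun y ↦ ψ y * u y) := hv.continuous
  have hGc : Continuous (g.gradSq fun y ↦ ψ y * u y) := (contMDiff_gradSq g hv).continuous
  have hGnn : ∀ x, 0 ≤ g.gradSq (fun y ↦ ψ y * u y) x := fun x ↦ g.innerDual_self_nonneg hg x _
  have hX0 : 0 ≤ ∫ x, g.gradSq (fun y ↦ ψ y * u y) x ∂g.riemVolume := integral_nonneg hGnn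
  have hV0 : 0 ≤ ∫ x, (ψ x * u x) ^ 2 ∂g.riemVolume := integral_nonneg fun x ↦ sq_nonneg _
  rw [integral_conformal_eq g hg hψ hu]
  simp_rw [show ∀ x, u x ^ 4 * ψ x ^ 4 = (ψ x * u x) ^ 4 from fun x ↦ by ring]
  have hsob := hS _ hv
  -- the lower bound `6X + rV ≤ ∫ (6|∇v|² + Rv²)`
  have i1 : Integrable (fun x ↦ 6 * g.gradSq (fun y ↦ ψ y * u y) x) g.riemVolume :=
    (g.integrable_of_continuous hGc).const_mul 6
  have i2 : Integrable (fun x ↦ r * (ψ x * u x) ^ 2) g.riemVolume :=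
    (g.integrable_of_continuous (hvc.pow 2)).const_mul r
  have i3 : Integrable (fun x ↦ 6 * g.gradSq (fun y ↦ ψ y * u y) x
      + g.scalarCurvature x * (ψ x * u x) ^ 2) g.riemVolume :=
    i1.add (g.integrable_of_continuous (hRc.mul (hvc.pow 2)))
  have hlow : 6 * (∫ x, g.gradSq (fun y ↦ ψ y * u y) x ∂g.riemVolume)
      + r * (∫ x, (ψ x * u x) ^ 2 ∂g.riemVolume) ≤
      ∫ x, (6 * g.gradSq (fun y ↦ ψ y * u y) x + g.scalarCurvature x * (ψ x * u x) ^ 2)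
        ∂g.riemVolume := by
    rw [← integral_const_mul, ← integral_const_mul, ← integral_add i1 i2]
    exact integral_mono (i1.add i2) i3 fun x ↦ by
      have h1 := hrR x
      have h2 := sq_nonneg (ψ x * u x)
      nlinarith
  calc r / (r * A + B + r) * Real.sqrt (∫ x, (ψ x * u x) ^ 4 ∂g.riemVolume)
      ≤ r / (r * A + B + r) * (A * ∫ x, g.gradSq (fun y ↦ ψ y * u y) x ∂g.riemVolume
          + B * ∫ x, (ψ x * u x) ^ 2 ∂g.riemVolume) :=
        mul_le_mul_of_nonneg_left hsob (div_pos hr hK).le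
    _ ≤ 6 * (∫ x, g.gradSq (fun y ↦ ψ y * u y) x ∂g.riemVolume)
          + r * (∫ x, (ψ x * u x) ^ 2 ∂g.riemVolume) := by
        rw [div_mul_eq_mul_div, div_le_iff₀ hK]
        nlinarith [mul_nonneg (mul_nonneg hr.le hA) hX0, mul_nonneg hB hX0, mul_nonneg hr.le hX0,
          mul_nonneg (mul_nonneg (mul_nonneg hr.le hr.le) hA) hV0,
          mul_nonneg (mul_nonneg hr.le hr.le) hV0]
    _ ≤ _ := hlow

end Integral

end YamabeSobolev

/-- **Helper H10 of line `green-blowup-conformal-entropy` — the Yamabe–Sobolev inequality of a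
scalar-positive conformal class, registered form** (summit binder, explicit arguments; see
`YamabeSobolev.yamabeSobolev_conformal_riemVolume`). If `R_g > 0` on the closed `4`-manifold there
is `Y > 0` such that for every smooth `ψ > 0` and smooth `u`,
`Y (∫ u⁴ψ⁴ dV_g)^{1/2} ≤ ∫ (6ψ²|∇u|²_g + ψ(R_g ψ − 6Δ_g ψ) u²) dV_g`, i.e.
`Y ‖u‖²_{L⁴(ĝ)} ≤ ∫ (6|∇u|²_ĝ + R_ĝ u²) dV_ĝ` for every `ĝ = ψ²g` of the class with the same `Y`
(conformal invariance of the Yamabe quotient + the Sobolev inequality of `(M, g)`). Lee–Parker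
1987, §3; Hebey 1999, Thm. 2.6. Helper for stub `stub_conformalGluing` (crux
stmt-SmoothPoincare4-10871). -/
theorem yamabeSobolev_conformal :
    ∀ (M : Type) [TopologicalSpace M] [T2Space M] [SecondCountableTopology M]
      [ChartedSpace (EuclideanSpace ℝ (Fin 4)) M] [IsManifold (𝓡 4) ∞ M] [CompactSpace M]
      [T3Space M] [MeasurableSpace M] [BorelSpace M]
      (g : PseudoRiemannianMetric (𝓡 4) ∞ (EuclideanSpace ℝ (Fin 4)) (TangentSpace (𝓡 4) : M → Type _))
      [g.HasLeviCivita] (hg : g.IsRiemannian), (∀ x, 0 < g.scalarCurvature x) →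
      ∃ Y : ℝ, 0 < Y ∧ ∀ (ψ : M → ℝ), ContMDiff (𝓡 4) 𝓘(ℝ, ℝ) ∞ ψ → (∀ x, 0 < ψ x) →
        ∀ (u : M → ℝ), ContMDiff (𝓡 4) 𝓘(ℝ, ℝ) ∞ u →
          Y * Real.sqrt (∫ x, u x ^ 4 * ψ x ^ 4 ∂(riemannianMeasure (g.toContMDiffRiemannianMetric hg))) ≤
            ∫ x, (6 * (ψ x ^ 2 * g.gradSq u x)
                + ψ x * (g.scalarCurvature x * ψ x - 6 * g.dalembertian ψ x) * u x ^ 2)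
              ∂(riemannianMeasure (g.toContMDiffRiemannianMetric hg)) := by
  intro M _ _ _ _ _ _ _ _ _ g _ hg hR
  rw [← PseudoRiemannianMetric.riemVolume_eq hg]
  exact YamabeSobolev.yamabeSobolev_conformal_riemVolume g hg hR

end Summit.SmoothPoincare4.SmoothPoincare4.Theorems

end
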